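import Literature.MathematicalPhysics.QuantumFieldTheory.Balaban1983to89.B3Ineq25Op116RegularTorus
import Literature.MathematicalPhysics.QuantumFieldTheory.Balaban1983to89.B3Op116KernelRegularTorusDecay
import Literature.MathematicalPhysics.QuantumFieldTheory.Balaban1983to89.B3Op116BoxRows

/-!
# Bałaban, *(Higgs)₂,₃ quantum fields in a finite volume III. Renormalization* [B3] — inequality (2.5) p. 424, THE (1.16) ALTERNATIVE, ON
THE TORUS UNDER PRINT'S REGIME ONLY: the (2.10)/(2.11)/`δG_k` inputs of FILE 5(b) DISCHARGED by the tree's hypothesis-free torus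
theorems — FILE 5(c) of the cell's (1.16) programme

statement-level skeleton of published theorems with citation tags; proofs where landed; nothing here is a claim about the Yang–Mills mass gap

T. Bałaban, Commun. Math. Phys. **88** (1983) 411–445 [cite: Balaban1983Higgs3]; part I, Commun. Math. Phys. **85** (1982) 603–636
[cite: Balaban1982Higgs1].  PDFs held: `paper:balaban1983-higgs-2-3-quantum-fields-finite-volume` (journal page = PDF page + 410;
p. 414 = `p0004.txt`, p. 424 = `p0014.txt`, p. 426 = `p0016.txt`).

CITATION HEADER (lean-in-tree rule).  Cell `lit-balaban` (HOME `run/shared/lean/pub/lit-balaban/`), Phase-2 proof seat **p40** gen 74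
(unit `lit-balaban-p40`; TAKING line HOME/STATUS 2026-08-23T07:40Z-stamped, «FILE 5(c)» announced there as the fully discharged
corollary).  SKELETON rows **B3.Eq2.5** (decl of record `B3Sect2StatementsPart2.ScaledKernels.Ineq25At`) / **B3.Eq1.16** (analytic half),
fold owner r15 — a located member (no head claim; the fold owner decides the head).  USED BY NAME, never restated: p40 g74's
`B3Ineq25Op116RegularTorus.ineq25At_op116_regularTorus` (FILE 5(b): (2.5) from the named inputs) and the tree's HYPOTHESIS-FREE torus
theorems that discharge those inputs — r14/r15/p33's `B3Ineq210RegularRegion.ineq210_regularRegion_univ_small` ((2.10) on r14's carrier),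
p33's `B3Ineq210MixedRegularRegion.ineq210_mixed_regularRegion_univ` (twice-differentiated per-piece (2.10)) with `mixedTermR_univ`, p35's
`B3Op116BoxRows.hcol_le_univ` ((2.11) Hölder row), p33 g61's `B3Ineq25SmoothLocalization.ineq25_smooth_regularNested` (the `δG_k` clause
with smooth localizations), r14's `B3Op116KernelRegularTorusDecay.ineq210_rate_mono`, the steward's `B1TorusRegionHSizes.isBigBlockUnion_univ`.

## What is printed (verbatim)

(2.5) p. 424 [PDF 14]: *"In the estimates we treat them as external fields and we use the inequalities: ‖h(an operator δG_k(Ω,Ω₂,B̃) or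
(1.16))h′‖_{1,α} ≤ O(e^{−δ₀dist(Ω₂,∂Ω)} or (e(L^kε)p(L^kε))^{n+n′})e^{−δ₀dist(supp h, supp h′)}, (2.5) where h, h′ are functions giving the
localizations of the vertices."*;  (1.16) p. 414 [PDF 4]: *"… for n, n′ sufficiently large, a kernel of the operator (1.16) is a
sufficiently regular function of both variables … This estimate follows easily from the properties of the propagators G_k(Ω,A) proved in the
next paper."*;  (2.10) p. 426 [PDF 16]: *"|G^η_{(j)}(Ω, B̃; x, x′)| ≤ O(1)(L^jη)^{−d+2}e^{−δ₁(L^jη)^{−1}|x−x′|}, (2.10) and if the propagator is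
differentiated, then for each differentiation, there is an additional factor (L^jη)^{−1} on the right side. This applies also to Hölder
norms"* ((2.11)).

## What this file proves, and how

**`ineq25At_op116_torus`**: for `d ≥ 1`, `L ≥ 2`, `a > 0`, `m² > 0`, a regularity budget `c ≥ 0`, the support size `m` and bump constants
`c₁, c₂ ≥ 0` of the smooth localization class, and orders `n, n′ ≥ 1` with `n + n′ > d`: there is a charge threshold `E₀ > 0` such that for
every charge datum with `e² ≤ E₀` there is a cube size `K₀min` such that for every Hölder index `0 ≤ α < 1` and every `K₀ ≥ K₀min` there are
`t > 0`, rates `0 < δ₁ ≤ 1`, `0 < δ₀` and constants `C, C_M, C_H, C_G ≥ 0` such that ON EVERY TORUS `T_ε` of dimension `d`, ratio `L`,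
`K₀ ∣ M`, at every scale `1 ≤ k ≤ K` with `≥ 3` cubes of side `L^kK₀` per direction and `L^kε ≤ 1`, for every big-block union `Ω₂`, all
backgrounds `Ã, B̃` with `B̃`, `Ã+B̃`, `Ã` (I.2.23)-regular (`δ_B, δ_{AB}, δ_A`), `L^kδ_B|e|, L^kδ_{AB}|e| ≤ t`, `L^kδ_B ≤ c|e|`, `sup_b|Ã_b| ≤ s`,
`(L^kε)|e|s ≤ 1`, every margin `r₀` and carrier parameters `e_Rp_R ≥ L^kε`:
`(sect2Smooth116 …).Ineq25At n n′ α (min δ₀ (δ₁/(4L)^{n+n′+1})) (C_G + K(c₁,c₂+2c₁,d,m)(valC+derC) + holC(…,ε^dC_H,…) + d·m·mixC)` —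
FILE 5(b)'s theorem with its five named inputs produced by the bracketed tree theorems at a COMMON cube size (the max of theirs) and a COMMON
rate `δ₁` (the min of theirs and `1`; `ineq210_rate_mono` and termwise rate weakening for the mixed and Hölder shapes).

## Honest scope / declared divergences (F7)

(i) Torus only; (ii) the constants `valC/derC/holC/mixC` remain the explicit `P, k, s, δ_A`-dependent expressions of 4β₂/4γ/5(b)-A (print's
`O(1)(e(L^kε)…)^{n+n′}` unsimplified), only the INPUT constants are uniform; (iii) `n, n′ ≥ 1`, `α < 1`; (iv) the regime is the conjunction
of the suppliers' regimes (charge threshold `E₀` and the budget `c` come from p33's `δG_k` member; the regularity of `Ã` itself is assumed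
besides that of `B̃`, `Ã+B̃`).  No `def`, no new named fact, no `sorry`; axioms standard.  Value = the hypothesis-free torus form of one located
estimate of B3 §2 — NOT summit progress and nothing about the Yang–Mills mass gap.
-/

noncomputable section

open scoped BigOperators

namespace Literature.MathematicalPhysics.QuantumFieldTheory.Balaban1983to89.B3Ineq25Op116Torus

open HiggsLattice (ChargeData ScalarField covDeriv)
open HiggsCovariance (propagatorK E)
open B1Eq230FluctCov (Ix cb)
open B1TorusChainTransport (hol)
open B1TorusCubeCover (half)
open B1TorusRegionHSizes (IsBigBlockUnion isBigBlockUnion_univ)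
open B3Ineq210RegularRegion (regRegionKernels ineq210_regularRegion_univ_small)
open B3Ineq210MixedRegularRegion (mixedTermR mixedTermR_univ ineq210_mixed_regularRegion_univ)
open B3Ineq211RegularTorus (IsAdm)
open B3Ineq25SmoothLocalization (sect2DeltaSmooth ineq25_smooth_regularNested)
open B3Ineq31SmoothLocalization (smoothConst)
open B3Ineq25Op116Smooth (sect2Smooth116)
open B3Op116DKernelRegularTorus (valC derC)
open B3Op116HolderKernelRegularTorus (holC)
open B3Op116MixedKernelRegularTorus (mixC)
open B3Op116KernelRegularTorusDecay (ineq210_rate_mono)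
open B3Op116BoxRows (hcol_le_univ)
open B3Ineq25Op116RegularTorus (ineq25At_op116_regularTorus)

variable {P : HiggsLattice.Params} {N : ℕ}

/-- rate weakening of a decay factor `exp(−ρ·t)`. [cite: Balaban1983Higgs3, (2.10) p.426] -/
private theorem exp_rate_mono {ρ ρ' t : ℝ} (h : ρ' ≤ ρ) (ht : 0 ≤ t) : Real.exp (-(ρ * t)) ≤ Real.exp (-(ρ' * t)) :=
  Real.exp_le_exp.mpr (by nlinarith)

/-- rate weakening of `exp(−ρ·u·s)`, `u, s ≥ 0`. [cite: Balaban1983Higgs3, (2.10) p.426] -/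
private theorem exp_rate_mono3 {ρ ρ' u s : ℝ} (h : ρ' ≤ ρ) (hu : 0 ≤ u) (hs : 0 ≤ s) :
    Real.exp (-(ρ * u * s)) ≤ Real.exp (-(ρ' * u * s)) := by
  apply Real.exp_le_exp.mpr
  have := mul_le_mul_of_nonneg_right (mul_le_mul_of_nonneg_right h hu) hs
  linarith

set_option maxHeartbeats 800000 in
/-- **INEQUALITY (2.5) OF [B3], THE (1.16) ALTERNATIVE, ON THE TORUS, UNDER PRINT'S REGIME ONLY** — all orders `n, n′ ≥ 1` with
`n + n′ > d`, every Hölder index `0 ≤ α < 1`.  For `d ≥ 1`, `L ≥ 2`, `a > 0`, `m² > 0`, a regularity budget `c ≥ 0`, support size `m`,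
bump constants `c₁, c₂ ≥ 0`: ∃ charge threshold `E₀ > 0`, ∀ charge data with `e² ≤ E₀`, ∃ `K₀min`, ∀ `0 ≤ α < 1`, ∀ `K₀ ≥ K₀min`,
∃ `t > 0`, `0 < δ₁ ≤ 1`, `δ₀ > 0`, `C, C_M, C_H, C_G ≥ 0`, such that on every torus `T_ε` (dimension `d`, ratio `L`, `K₀ ∣ M`), every scale
`1 ≤ k ≤ K` with `≥ 3` cubes per direction and `L^kε ≤ 1`, every big-block union `Ω₂ ⊆ T_ε`, all backgrounds `Ã, B̃` with `B̃`, `Ã+B̃`, `Ã`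
(I.2.23)-regular (`δ_B, δ_{AB}, δ_A ≥ 0`), `L^kδ_B|e| ≤ t`, `L^kδ_{AB}|e| ≤ t`, `L^kδ_B ≤ c|e|`, `sup_b|Ã_b| ≤ s` (`s ≥ 0`), `(L^kε)|e|s ≤ 1`,
every margin `r₀` and carrier parameters `0 ≤ e_Rp_R`, `L^kε ≤ e_Rp_R`:
`(sect2Smooth116 …).Ineq25At n n′ α (min δ₀ (δ₁/(4L)^{n+n′+1})) (C_G + K(c₁,c₂+2c₁,d,m)·(valC(n+n′)+derC(n+n′)) + holC(…ε^dC_H…)(n+n′−1)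
+ d·m·mixC(n+n′))` — i.e. `‖hδG_k(T,Ω₂,B̃)h′‖_{1,α}` AND `‖h(1.16)_{n,n′}h′‖_{1,α} ≤ C·(e_Rp_R)^{n+n′}e^{−δdist(supp h,supp h′)}` for all
smooth localization functions of the carrier.  FILE 5(b)'s `ineq25At_op116_regularTorus` with its inputs discharged by
`ineq210_regularRegion_univ_small` ((2.10) for `B̃` and `Ã+B̃`), `ineq210_mixed_regularRegion_univ`, `hcol_le_univ` ((2.11)),
`ineq25_smooth_regularNested` (`δG_k`), at a common cube size and a common rate.
[cite: Balaban1983Higgs3, (2.5) p.424, (1.16) p.414, (1.32) p.420, (2.10)-(2.11) p.426] [cite: Balaban1982Higgs1, Prop. 2.1 (2.23)-(2.25) p.610, (3.44) p.619] -/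
theorem ineq25At_op116_torus (d L : ℕ) (hd : 1 ≤ d) (hL : 2 ≤ L) {a : ℝ} (ha : 0 < a) {msq : ℝ} (hmsq : 0 < msq)
    {c : ℝ} (hc : 0 ≤ c) (N m : ℕ) {c₁ c₂ : ℝ} (hc₁ : 0 ≤ c₁) (hc₂ : 0 ≤ c₂)
    (n n' : ℕ) (hn : 1 ≤ n) (hn' : 1 ≤ n') (hdn : d < n + n') :
    ∃ E₀ : ℝ, 0 < E₀ ∧ ∀ (C : ChargeData N), C.e ^ 2 ≤ E₀ →
      ∃ K₀min : ℕ, ∀ {α : ℝ}, 0 ≤ α → α < 1 → ∀ K₀ : ℕ, K₀min ≤ K₀ →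
      ∃ t δ₁ δ₀ Cst CM CH CG : ℝ, 0 < t ∧ 0 < δ₁ ∧ δ₁ ≤ 1 ∧ 0 < δ₀ ∧ 0 ≤ Cst ∧ 0 ≤ CM ∧ 0 ≤ CH ∧ 0 ≤ CG ∧
      ∀ (P : HiggsLattice.Params) (hP1 : 1 < P.L), P.d = d → P.L = L → K₀ ∣ P.M →
      ∀ {k : ℕ}, 1 ≤ k → k ≤ P.K → (∀ μ, 3 * half P k K₀ ≤ P.sitesPerDir 0 μ) → P.mesh k ≤ 1 →
      ∀ (Ω₂ : Finset (HiggsLattice.Site P 0)), IsBigBlockUnion k K₀ Ω₂ →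
      ∀ (A B : HiggsLattice.VecField P 0) {δB δAB δA s : ℝ}, 0 ≤ δB → 0 ≤ δAB → 0 ≤ δA → 0 ≤ s →
        (∀ (z : HiggsLattice.Site P 0) (μ ν : Fin P.d), |B ⟨z.shift ν, μ⟩ - B ⟨z, μ⟩| ≤ δB) →
        (∀ (z : HiggsLattice.Site P 0) (μ ν : Fin P.d), |(A + B) ⟨z.shift ν, μ⟩ - (A + B) ⟨z, μ⟩| ≤ δAB) →
        (∀ (z : HiggsLattice.Site P 0) (μ ν : Fin P.d), |A ⟨z.shift ν, μ⟩ - A ⟨z, μ⟩| ≤ δA) →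
        (P.L : ℝ) ^ k * δB * |C.e| ≤ t → (P.L : ℝ) ^ k * δAB * |C.e| ≤ t → (P.L : ℝ) ^ k * δB ≤ c * |C.e| →
        (∀ b : HiggsLattice.PBond P 0, |A b| ≤ s) → P.mesh k * (|C.e| * s) ≤ 1 →
      ∀ (r₀ : ℕ) {eR pR : ℝ}, 0 ≤ eR * pR → P.mesh k ≤ eR * pR → Ix N →
        (sect2Smooth116 hP1 C Finset.univ Ω₂ A B msq a k K₀ r₀ m c₁ c₂ eR pR).Ineq25At n n' α
          (min δ₀ (δ₁ / (4 * (P.L : ℝ)) ^ (n + n' + 1)))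
          (CG + (smoothConst P.d m c₁ (c₂ + 2 * c₁) *
              (valC P N C k a δ₁ Cst s δA (n + n') + derC P N C k a δ₁ Cst s δA (n + n'))
            + (holC P N C k a δ₁ Cst s δA α (P.mesh 0 ^ P.d * CH) (n + n' - 1)
              + P.d * m * mixC P N C k a δ₁ Cst CM s δA (n + n')))) := by
  obtain ⟨E₀, hE₀, hG⟩ := ineq25_smooth_regularNested d L hd hL ha hmsq hc N m hc₁ hc₂
  refine ⟨E₀, hE₀, fun C heC => ?_⟩
  obtain ⟨K₄, hK₄⟩ := hG C heC
  obtain ⟨K₁, hK₁⟩ := ineq210_regularRegion_univ_small d L hd hL ha hmsq N C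
  obtain ⟨K₂, hK₂⟩ := ineq210_mixed_regularRegion_univ d L hd hL ha hmsq N C
  obtain ⟨K₃, hK₃⟩ := hcol_le_univ d L hd hL ha hmsq N C
  refine ⟨max (max K₁ K₂) (max K₃ K₄), fun {α} hα0 hα1 K₀ hK₀ => ?_⟩
  obtain ⟨t₁, δ₁, C₁, ht₁, hδ₁, hC₁, h1⟩ := hK₁ K₀ ((le_max_left K₁ K₂).trans ((le_max_left _ _).trans hK₀))
  obtain ⟨t₂, δ₂, C₂, ht₂, hδ₂, hC₂, h2⟩ := hK₂ K₀ ((le_max_right K₁ K₂).trans ((le_max_left _ _).trans hK₀))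
  obtain ⟨t₃, δ₃, C₃, ht₃, hδ₃, hC₃, h3⟩ := hK₃ hα0 hα1 K₀ ((le_max_left K₃ K₄).trans ((le_max_right _ _).trans hK₀))
  obtain ⟨t₄, δ₄, C₄, ht₄, hδ₄, hC₄, h4⟩ := hK₄ hα0 hα1 K₀ ((le_max_right K₃ K₄).trans ((le_max_right _ _).trans hK₀))
  -- the common smallness threshold and the common rate
  set t : ℝ := min (min t₁ t₂) (min t₃ t₄) with htdef
  set δ : ℝ := min (min δ₁ δ₂) (min δ₃ 1) with hδdef
  have htt₁ : t ≤ t₁ := (min_le_left _ _).trans (min_le_left _ _)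
  have htt₂ : t ≤ t₂ := (min_le_left _ _).trans (min_le_right _ _)
  have htt₃ : t ≤ t₃ := (min_le_right _ _).trans (min_le_left _ _)
  have htt₄ : t ≤ t₄ := (min_le_right _ _).trans (min_le_right _ _)
  have hδδ₁ : δ ≤ δ₁ := (min_le_left _ _).trans (min_le_left _ _)
  have hδδ₂ : δ ≤ δ₂ := (min_le_left _ _).trans (min_le_right _ _)
  have hδδ₃ : δ ≤ δ₃ := (min_le_right _ _).trans (min_le_left _ _)
  have hδ1 : δ ≤ 1 := (min_le_right _ _).trans (min_le_right _ _)
  have hδ0 : 0 < δ := lt_min (lt_min hδ₁ hδ₂) (lt_min hδ₃ one_pos)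
  refine ⟨t, δ, δ₄, C₁, C₂, C₃, C₄, lt_min (lt_min ht₁ ht₂) (lt_min ht₃ ht₄), hδ0, hδ1, hδ₄, hC₁.le, hC₂.le, hC₃.le, hC₄.le, ?_⟩
  intro P hP1 hPd hPL hK₀M k hk hkK h3h hmesh Ω₂ hΩ₂ A B δB δAB δA s hδB hδAB hδA hs hregB hregAB hregA htB htAB hcB hA ht1 r₀ eR pR
    ht0 ht i₀
  have hL2 : 2 ≤ P.L := by rw [hPL]; exact hL
  have hdP : P.d < n + n' := by rw [hPd]; exact hdn
  have hε := P.mesh_pos 0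
  -- (2.10) for `B̃` and `Ã+B̃` at the common rate
  have h210B : (regRegionKernels hP1 C Finset.univ B msq a k K₀).Ineq210 δ C₁ :=
    ineq210_rate_mono hC₁.le hδδ₁ (h1 P hP1 hPd hPL hK₀M hk hkK h3h hmesh B hδB hregB (htB.trans htt₁))
  have h210AB : (regRegionKernels hP1 C Finset.univ (A + B) msq a k K₀).Ineq210 δ C₁ :=
    ineq210_rate_mono hC₁.le hδδ₁ (h1 P hP1 hPd hPL hK₀M hk hkK h3h hmesh (A + B) hδAB hregAB (htAB.trans htt₁))
  -- the twice-differentiated per-piece (2.10) at the common rate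
  have hLj : ∀ j : ℕ, (0 : ℝ) < (P.L : ℝ) ^ j := fun j => by have := P.hL; positivity
  have hmix : ∀ (X : HiggsLattice.VecField P 0) {δX : ℝ}, 0 ≤ δX →
      (∀ (z : HiggsLattice.Site P 0) (μ ν : Fin P.d), |X ⟨z.shift ν, μ⟩ - X ⟨z, μ⟩| ≤ δX) → (P.L : ℝ) ^ k * δX * |C.e| ≤ t →
      ∀ (j : ℕ) (μ ν : Fin P.d) (x x' : HiggsLattice.Site P 0),
        mixedTermR C Finset.univ X msq a k j μ ν x x'
          ≤ C₂ * (P.mesh j ^ P.d)⁻¹ * Real.exp (-(δ * ((HiggsLattice.Site.tdist x x' : ℝ) / (P.L : ℝ) ^ j))) := by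
    intro X δX hδX hregX htX j μ ν x x'
    rw [mixedTermR_univ]
    refine (h2 P hPd hPL hK₀M hk hkK h3h hmesh X hδX hregX (htX.trans htt₂) j μ ν x x').trans ?_
    exact mul_le_mul_of_nonneg_left (exp_rate_mono hδδ₂ (div_nonneg (Nat.cast_nonneg _) (hLj j).le))
      (mul_nonneg hC₂.le (inv_nonneg.mpr (pow_nonneg (P.mesh_pos j).le _)))
  have hmixB := hmix B hδB hregB htB
  have hmixAB := hmix (A + B) hδAB hregAB htAB
  -- the (2.11) Hölder row of `G_k(T,B̃)` at the common rate
  have h211 : ∀ (μ : Fin P.d) (x₁ x₂ y : HiggsLattice.Site P 0), x₁ ≠ x₂ → ∀ Γ : List (HiggsLattice.Site P 0), IsAdm x₁ x₂ Γ →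
      (∑ i : Ix N, ‖hol C B x₁ Γ (covDeriv C B (propagatorK C Finset.univ B msq a k (cb P N 0 (y, i))) ⟨x₂, μ⟩)
          - covDeriv C B (propagatorK C Finset.univ B msq a k (cb P N 0 (y, i))) ⟨x₁, μ⟩‖)
          / (P.mesh 0 * (HiggsLattice.Site.tdist x₁ x₂ : ℝ)) ^ α
        ≤ ∑ j ∈ Finset.range k, (P.mesh 0 ^ P.d * C₃) * P.mesh j ^ (((1 : ℝ) - α) - (P.d : ℝ)) *
            (Real.exp (-(δ * (P.mesh j)⁻¹ * (P.mesh 0 * (HiggsLattice.Site.tdist x₁ y : ℝ)))) +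
              Real.exp (-(δ * (P.mesh j)⁻¹ * (P.mesh 0 * (HiggsLattice.Site.tdist x₂ y : ℝ))))) := by
    intro μ x₁ x₂ y hne Γ hΓ
    refine (h3 P hP1 hPd hPL hK₀M hk hkK h3h hmesh B hδB hregB (htB.trans htt₃) μ x₁ x₂ y hne Γ hΓ).trans ?_
    refine Finset.sum_le_sum fun j _ => ?_
    have hcj : 0 ≤ (P.mesh 0 ^ P.d * C₃) * P.mesh j ^ (((1 : ℝ) - α) - (P.d : ℝ)) :=
      mul_nonneg (mul_nonneg (pow_nonneg hε.le _) hC₃.le) (Real.rpow_nonneg (P.mesh_pos j).le _)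
    refine mul_le_mul_of_nonneg_left (add_le_add ?_ ?_) hcj
    · exact exp_rate_mono3 hδδ₃ (inv_nonneg.mpr (P.mesh_pos j).le) (mul_nonneg hε.le (Nat.cast_nonneg _))
    · exact exp_rate_mono3 hδδ₃ (inv_nonneg.mpr (P.mesh_pos j).le) (mul_nonneg hε.le (Nat.cast_nonneg _))
  -- the `δG_k(T,Ω₂,B̃)` clause with smooth localizations
  have hδG : (sect2DeltaSmooth hP1 C Finset.univ Ω₂ B msq a k K₀ r₀ m c₁ c₂).Ineq25 α δ₄ C₄ :=
    h4 P hP1 hPd hPL hK₀M hk hkK h3h hmesh Finset.univ Ω₂ isBigBlockUnion_univ hΩ₂ (Finset.subset_univ _) B hδB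
      (fun z _ μ ν => hregB z μ ν) (htB.trans htt₄) hcB r₀
  exact ineq25At_op116_regularTorus hL2 hk hkK hmsq ha n n' hn hn' hdP hα0 hα1 hc₁ hc₂ ht0 ht hC₄.le hδG hδ0 hδ1 hC₁.le hC₂.le
    h210B hmixB h210AB hmixAB i₀ hs hA hδA hregA ht1 (mul_nonneg (pow_nonneg hε.le _) hC₃.le) h211

end Literature.MathematicalPhysics.QuantumFieldTheory.Balaban1983to89.B3Ineq25Op116Torus

end
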